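import Mathlib
import Literature.AlgebraicGeometry.Tropical.TorusCycles
import Summits.HodgeConjecture.HodgeConjecture.Theorems.TropicalWeilObstructionTropicalWeilVanishingFlatObstructionLinAlg
import HarnessLib

/-!
# Crux `TropicalWeilVanishing` (stmt-HodgeConjecture-18478) — the FIXED POINTS of `J` and the Q-SQUARES of the tropical
# theta divisor of a Weil period: `(J-1)(J+1) = -2`, the `2ⁿ` fixed points `½(J+1)ℤ²ⁿ`, the order-4 rotation `φ_c` about a
# fixed point acting freely on the lattice, and `4 ∣ #(every φ_c-stable finite set of lattice points)`

Route `TropicalWeilObstruction` of `HodgeConjecture`; cell `pub-hodge-tropical` (Hodge NEGATION SINK — scoped exploration,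
cap 2 seats, no summit claim), seat tropical-2 gen 17 (`prover-pub-hodge-tropical-2-g17-0`, 2026-08-24), written while
REFEREEING tropical-1's K1-SCOPE §10 (c)/(e) (the sheet structure of the tropical theta divisor `Θ` at a Weil-generic period).
HONEST FRAMING: elementary matrix algebra about the tree's complex structure `J = weilJ n` on `ℝ²ⁿ`; it is the mechanism
behind the referee's THEOREM V (HOME `certificates/signedcycles/referee-tropical2-g17/VORONOI-WEIL-GENERIC.md`): the
non-triangular Delaunay 2-faces of `(ℤ²ⁿ, Q)` at a Weil-generic `Q` — dually the 4-valent self-crossing ridges of `Θ` found by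
tropical-2 gen 16 (R-§10-c2: exactly 15 at n = 4) — are Q-squares centred at the `2ⁿ − 1` non-zero fixed points of `J` on the
torus, and every star there carries a free `ℤ/4`. It decides nothing about K1 (`TropicalWeilVanishing`, OPEN), K1_∂ (OPEN) or K2
(XL), and nothing here bears on the Hodge conjecture. negation-sink work.

Contents (all `n`, vectors `Fin (2 * n) → ℝ`, `J = weilJ n`, `J² = -1` from the tree):
* `weilJ_sub_one_mul_weilJ_add_one` — `(J - 1)(J + 1) = -2`.
* `fixed_iff` — `y` is a fixed point of `J` on `ℝ²ⁿ/ℤ²ⁿ` (`Jy - y ∈ ℤ²ⁿ`) iff `2y ∈ (J+1)ℤ²ⁿ`; `exists_eq_weilJ_add_one_iff` — an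
  integer vector `u` lies in `(J+1)ℤ²ⁿ` iff `u_k ≡ u_{k+n} (mod 2)` for all `k < n` (the "J-invariant classes mod 2"; `2ⁿ` of them).
* the rotation `φ_c(p) = Jp - (Jc - c)` about `c`: `rot_fixed_iff` (`φ_c p = p ↔ p = c`), `rot_rot` (`φ_c² p = 2c - p`),
  `rot_pow_four`, `rot_injective`, `rot_ne_self`/`rot_rot_ne_self` (no lattice point is fixed by `φ_c` or `φ_c²` when `c` is not
  one), `rot_intCast` (`φ_c` preserves `ℤ²ⁿ` when `Jc - c ∈ ℤ²ⁿ`), `rot_sub_center` (`φ_c p - c = J(p - c)`).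
* `quadForm_weilJ_mulVec`, `dotProduct_mulVec_weilJ_mulVec_self` — for symmetric `Q` commuting with `J`: `Q[Jw] = Q[w]`,
  `⟨w, Jw⟩_Q = 0`; hence `quadForm_rot_sub_center` (`φ_c` preserves `Q`-distance to `c`) and `rot_orbit_isSquare` (an orbit
  `c+w, c+Jw, c-w, c-Jw` has equal `Q`-sides `2Q[w]` and `Q`-orthogonal adjacent sides: a Q-square centred at `c`).
* `two_smul_squareCenter` — the centre of ANY lattice Q-square `{a, a+e, a+Je, a+e+Je}` satisfies `2·centre = (J+1)(a - Ja + e)`,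
  so it is a fixed point of `J` on the torus (`fixed_iff`).
* `four_dvd_card_of_rot_stable` — **a finite set of points not containing `c` and stable under `φ_c` has cardinality divisible
  by 4** (free `ℤ/4`-action: the orbit `p, φp, φ²p, φ³p` has four distinct points and its complement is again stable) — the
  reason every face number of the star of a fixed-point square, e.g. the number of top-dimensional Delaunay cells through it,
  is `≡ 0 (mod 4)`.
Mathlib + the tree's `weilJ` algebra (`TropicalWeilVanishing.weilJ_mul_weilJ` &c.); nothing is defined; no named fact; no sorry.

## References

* [Zharkov2020TropicalWeil] I. Zharkov, Tropical abelian varieties, Weil classes and the Hodge conjecture, arXiv:2002.02347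
  (2020), §2 (pp. 2–4): the tropical Weil tori `ℝ²ⁿ/Qℤ²ⁿ`, `QJ = JQ`, and their theta divisors.
* [MikhalkinZharkov2014Eigenwave] G. Mikhalkin, I. Zharkov, Tropical eigenwave and intermediate Jacobians, LN UMI 15 (2014),
  §5 (tropical theta divisor = corner locus of the lattice Voronoi function).
-/

set_option linter.dupNamespace false

noncomputable section

open scoped BigOperators Matrix
open Matrix Literature.AlgebraicGeometry.Tropical

namespace Summit.HodgeConjecture.HodgeConjecture.Theorems.TropicalWeilVanishing.FixedPoints

variable {n : ℕ}

/-! ### `(J - 1)(J + 1) = -2` and the fixed points of `J` on the torus -/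

/-- `(J - 1)(J + 1) = J² - 1 = -2`. [cite: Zharkov2020TropicalWeil, §2 (pp. 2–4)] -/
theorem weilJ_sub_one_mul_weilJ_add_one :
    (weilJ n - 1) * (weilJ n + 1) = -(2 : Matrix (Fin (2 * n)) (Fin (2 * n)) ℝ) := by
  rw [sub_mul, one_mul, mul_add, mul_one, weilJ_mul_weilJ]
  have h2 : (2 : Matrix (Fin (2 * n)) (Fin (2 * n)) ℝ) = 1 + 1 := by norm_num
  rw [h2]; abel

/-- `J(Jv) = -v`, pointwise form used throughout. [cite: Zharkov2020TropicalWeil, §2 (pp. 2–4)] -/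
theorem weilJ_mulVec_weilJ_mulVec_apply (v : Fin (2 * n) → ℝ) (a : Fin (2 * n)) :
    (weilJ n *ᵥ (weilJ n *ᵥ v)) a = -v a := by
  rw [weilJ_mulVec_weilJ_mulVec]; rfl

/-- **Fixed points of `J` on `ℝ²ⁿ/ℤ²ⁿ`.** `Jy ≡ y (mod ℤ²ⁿ)` iff `2y ∈ (J+1)ℤ²ⁿ` (multiply by `-(J+1)`, resp. by `J-1`, and use
`(J-1)(J+1) = -2`). [folklore] -/
theorem fixed_iff (y : Fin (2 * n) → ℝ) :
    (∃ v : Fin (2 * n) → ℤ, weilJ n *ᵥ y - y = fun a => (v a : ℝ)) ↔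
    (∃ u : Fin (2 * n) → ℤ, (2 : ℝ) • y = (weilJ n *ᵥ fun a => (u a : ℝ)) + fun a => (u a : ℝ)) := by
  constructor
  · rintro ⟨v, hv⟩
    refine ⟨-v, ?_⟩
    have hneg : (fun a => (((-v) a : ℤ) : ℝ)) = -(fun a => (v a : ℝ)) := by ext a; simp
    rw [hneg, Matrix.mulVec_neg]
    have h : weilJ n *ᵥ (weilJ n *ᵥ y - y) = weilJ n *ᵥ (fun a => (v a : ℝ)) := congrArg (weilJ n).mulVec hv
    rw [Matrix.mulVec_sub, weilJ_mulVec_weilJ_mulVec] at h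
    ext a
    have h1 := congrFun h a; have h2 := congrFun hv a
    simp only [Pi.sub_apply, Pi.neg_apply, Pi.add_apply, Pi.smul_apply, smul_eq_mul] at h1 h2 ⊢
    linarith
  · rintro ⟨u, hu⟩
    refine ⟨-u, ?_⟩
    have hneg : (fun a => (((-u) a : ℤ) : ℝ)) = -(fun a => (u a : ℝ)) := by ext a; simp
    rw [hneg]
    have h : weilJ n *ᵥ ((2 : ℝ) • y) = weilJ n *ᵥ ((weilJ n *ᵥ fun a => (u a : ℝ)) + fun a => (u a : ℝ)) :=
      congrArg (weilJ n).mulVec hu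
    rw [Matrix.mulVec_smul, Matrix.mulVec_add, weilJ_mulVec_weilJ_mulVec] at h
    ext a
    have h1 := congrFun h a; have h2 := congrFun hu a
    simp only [Pi.sub_apply, Pi.neg_apply, Pi.add_apply, Pi.smul_apply, smul_eq_mul] at h1 h2 ⊢
    linarith

/-- **`(J+1)ℤ²ⁿ` = the `J`-invariant classes.** An integer vector `u` is of the form `(J+1)v` with `v` integral iff
`u_k ≡ u_{k+n} (mod 2)` for every `k < n` (solve `v_k = (u_k + u_{k+n})/2`, `v_{k+n} = (u_{k+n} - u_k)/2`). So the fixed points of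
`J` on `ℝ²ⁿ/ℤ²ⁿ` are the `2ⁿ` half-lattice points `½u`, `u_k ≡ u_{k+n}`. [folklore] -/
theorem exists_eq_weilJ_add_one_iff (u : Fin (2 * n) → ℤ) :
    (∃ v : Fin (2 * n) → ℤ,
      (fun a => (u a : ℝ)) = (weilJ n *ᵥ fun a => (v a : ℝ)) + fun a => (v a : ℝ)) ↔
    ∀ k : Fin n, u ⟨(k : ℕ), by omega⟩ ≡ u ⟨(k : ℕ) + n, by omega⟩ [ZMOD 2] := by
  constructor
  · rintro ⟨v, hv⟩ k
    have hlo := congrFun hv ⟨(k : ℕ), by omega⟩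
    have hhi := congrFun hv ⟨(k : ℕ) + n, by omega⟩
    simp only [Pi.add_apply, weilJ_mulVec_apply_lo, weilJ_mulVec_apply_hi] at hlo hhi
    have e1 : u ⟨(k : ℕ), by omega⟩ = -v ⟨(k : ℕ) + n, by omega⟩ + v ⟨(k : ℕ), by omega⟩ := by
      exact_mod_cast hlo
    have e2 : u ⟨(k : ℕ) + n, by omega⟩ = v ⟨(k : ℕ), by omega⟩ + v ⟨(k : ℕ) + n, by omega⟩ := by
      exact_mod_cast hhi
    rw [Int.modEq_iff_dvd, e1, e2]
    exact ⟨v ⟨(k : ℕ) + n, by omega⟩, by ring⟩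
  · intro h
    -- `t k = (u_{k+n} - u_k)/2`, an integer by hypothesis
    have ht : ∀ k : Fin n, u ⟨(k : ℕ) + n, by omega⟩ - u ⟨(k : ℕ), by omega⟩ =
        2 * ((u ⟨(k : ℕ) + n, by omega⟩ - u ⟨(k : ℕ), by omega⟩) / 2) := fun k =>
      (Int.mul_ediv_cancel' (Int.modEq_iff_dvd.mp (h k))).symm
    refine ⟨fun a => if ha : (a : ℕ) < n then u a + (u ⟨(a : ℕ) + n, by omega⟩ - u a) / 2
      else (u a - u ⟨(a : ℕ) - n, by omega⟩) / 2, ?_⟩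
    ext a
    rcases fin_two_mul_cases a with ⟨k, rfl⟩ | ⟨k, rfl⟩
    · simp only [Pi.add_apply, weilJ_mulVec_apply_lo]
      have hk : ((⟨(k : ℕ), by omega⟩ : Fin (2 * n)) : ℕ) < n := k.2
      have hk' : ¬ ((⟨(k : ℕ) + n, by omega⟩ : Fin (2 * n)) : ℕ) < n := by simp
      rw [dif_pos hk, dif_neg hk']
      have e : (⟨((⟨(k : ℕ) + n, by omega⟩ : Fin (2 * n)) : ℕ) - n, by omega⟩ : Fin (2 * n)) = ⟨(k : ℕ), by omega⟩ :=
        Fin.ext (by simp)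
      rw [e]; push_cast; ring
    · simp only [Pi.add_apply, weilJ_mulVec_apply_hi]
      have hk : ((⟨(k : ℕ), by omega⟩ : Fin (2 * n)) : ℕ) < n := k.2
      have hk' : ¬ ((⟨(k : ℕ) + n, by omega⟩ : Fin (2 * n)) : ℕ) < n := by simp
      rw [dif_pos hk, dif_neg hk']
      have e : (⟨((⟨(k : ℕ) + n, by omega⟩ : Fin (2 * n)) : ℕ) - n, by omega⟩ : Fin (2 * n)) = ⟨(k : ℕ), by omega⟩ :=
        Fin.ext (by simp)
      rw [e]
      have h2 : (u ⟨(k : ℕ) + n, by omega⟩ : ℝ) - u ⟨(k : ℕ), by omega⟩ =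
          2 * (((u ⟨(k : ℕ) + n, by omega⟩ - u ⟨(k : ℕ), by omega⟩) / 2 : ℤ) : ℝ) := by
        exact_mod_cast ht k
      push_cast at h2 ⊢
      linarith

/-! ### The rotation `φ_c(p) = Jp - (Jc - c)` about a point `c` -/

/-- `φ_c p - c = J (p - c)`: `φ_c` is the rotation by `J` about `c`. [folklore] -/
theorem rot_sub_center (c p : Fin (2 * n) → ℝ) :
    weilJ n *ᵥ p - (weilJ n *ᵥ c - c) - c = weilJ n *ᵥ (p - c) := by
  rw [Matrix.mulVec_sub]; abel

/-- `φ_c p = p ↔ p = c` (`J - 1` is injective: `J w = w ⟹ -w = J(Jw) = Jw = w`). [folklore] -/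
theorem rot_fixed_iff (c p : Fin (2 * n) → ℝ) :
    weilJ n *ᵥ p - (weilJ n *ᵥ c - c) = p ↔ p = c := by
  constructor
  · intro h
    have hw : weilJ n *ᵥ (p - c) = p - c := by
      rw [← rot_sub_center, h]
    have h2 : weilJ n *ᵥ (weilJ n *ᵥ (p - c)) = weilJ n *ᵥ (p - c) := congrArg (weilJ n).mulVec hw
    rw [weilJ_mulVec_weilJ_mulVec, hw] at h2
    -- h2 : -(p - c) = p - c
    have h3 : p - c = 0 := by
      have h4 : (2 : ℝ) • (p - c) = 0 := by rw [two_smul]; nth_rw 1 [← h2]; simp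
      exact (smul_eq_zero.mp h4).resolve_left (by norm_num)
    exact sub_eq_zero.mp h3
  · rintro rfl; simp

/-- `φ_c (φ_c p) = 2c - p`: `φ_c²` is the central reflection in `c`. [folklore] -/
theorem rot_rot (c p : Fin (2 * n) → ℝ) :
    weilJ n *ᵥ (weilJ n *ᵥ p - (weilJ n *ᵥ c - c)) - (weilJ n *ᵥ c - c) = (2 : ℝ) • c - p := by
  simp only [Matrix.mulVec_sub, weilJ_mulVec_weilJ_mulVec, two_smul]
  abel

/-- `φ_c⁴ = id`. [folklore] -/
theorem rot_pow_four (c p : Fin (2 * n) → ℝ) :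
    (fun q => weilJ n *ᵥ q - (weilJ n *ᵥ c - c))^[4] p = p := by
  simp only [Function.iterate_succ, Function.iterate_zero, Function.comp_apply, id]
  rw [rot_rot, rot_rot]; simp

/-- `φ_c` is injective. [folklore] -/
theorem rot_injective (c : Fin (2 * n) → ℝ) :
    Function.Injective fun p => weilJ n *ᵥ p - (weilJ n *ᵥ c - c) := by
  intro p q h
  have h1 : weilJ n *ᵥ p = weilJ n *ᵥ q := sub_left_injective h
  have h2 : weilJ n *ᵥ (weilJ n *ᵥ p) = weilJ n *ᵥ (weilJ n *ᵥ q) := congrArg (weilJ n).mulVec h1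
  rwa [weilJ_mulVec_weilJ_mulVec, weilJ_mulVec_weilJ_mulVec, neg_inj] at h2

/-- No point other than `c` is fixed by `φ_c`. [folklore] -/
theorem rot_ne_self {c p : Fin (2 * n) → ℝ} (h : p ≠ c) :
    weilJ n *ᵥ p - (weilJ n *ᵥ c - c) ≠ p := fun h' => h ((rot_fixed_iff c p).mp h')

/-- No point other than `c` is fixed by `φ_c²` (`2c - p = p ⟹ p = c`). [folklore] -/
theorem rot_rot_ne_self {c p : Fin (2 * n) → ℝ} (h : p ≠ c) :
    weilJ n *ᵥ (weilJ n *ᵥ p - (weilJ n *ᵥ c - c)) - (weilJ n *ᵥ c - c) ≠ p := by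
  rw [rot_rot]; intro h'
  apply h
  have h2 : (2 : ℝ) • c = (2 : ℝ) • p :=
    calc (2 : ℝ) • c = ((2 : ℝ) • c - p) + p := by abel
      _ = p + p := by rw [h']
      _ = (2 : ℝ) • p := (two_smul ℝ p).symm
  exact (smul_right_injective (Fin (2 * n) → ℝ) (by norm_num : (2 : ℝ) ≠ 0) h2).symm

/-- `J` maps integer vectors to integer vectors (explicitly: `(Jz)_k = -z_{k+n}`, `(Jz)_{k+n} = z_k`). [folklore] -/
theorem weilJ_mulVec_intCast (z : Fin (2 * n) → ℤ) :
    ∃ z' : Fin (2 * n) → ℤ, weilJ n *ᵥ (fun a => (z a : ℝ)) = fun a => (z' a : ℝ) := by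
  refine ⟨fun a => if ha : (a : ℕ) < n then -z ⟨(a : ℕ) + n, by omega⟩ else z ⟨(a : ℕ) - n, by omega⟩, ?_⟩
  ext a
  rcases fin_two_mul_cases a with ⟨k, rfl⟩ | ⟨k, rfl⟩
  · rw [weilJ_mulVec_apply_lo]
    have hk : ((⟨(k : ℕ), by omega⟩ : Fin (2 * n)) : ℕ) < n := k.2
    simp only [dif_pos hk]; push_cast; rfl
  · rw [weilJ_mulVec_apply_hi]
    have hk' : ¬ ((⟨(k : ℕ) + n, by omega⟩ : Fin (2 * n)) : ℕ) < n := by simp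
    simp only [dif_neg hk']
    have e : (⟨((⟨(k : ℕ) + n, by omega⟩ : Fin (2 * n)) : ℕ) - n, by omega⟩ : Fin (2 * n)) = ⟨(k : ℕ), by omega⟩ :=
      Fin.ext (by simp)
    rw [e]

/-- `φ_c` preserves the lattice `ℤ²ⁿ` as soon as `Jc - c ∈ ℤ²ⁿ` (i.e. `c` is a fixed point of `J` on the torus). [folklore] -/
theorem rot_intCast {c : Fin (2 * n) → ℝ} (hc : ∃ v : Fin (2 * n) → ℤ, weilJ n *ᵥ c - c = fun a => (v a : ℝ))
    (z : Fin (2 * n) → ℤ) :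
    ∃ z' : Fin (2 * n) → ℤ, weilJ n *ᵥ (fun a => (z a : ℝ)) - (weilJ n *ᵥ c - c) = fun a => (z' a : ℝ) := by
  obtain ⟨v, hv⟩ := hc
  obtain ⟨w, hw⟩ := weilJ_mulVec_intCast z
  refine ⟨w - v, ?_⟩
  rw [hv, hw]; ext a; simp

/-! ### `Q`-squares: `J` is a `Q`-isometry for symmetric `J`-commuting `Q` -/

/-- `Q (J w) = J (Q w)` when `QJ = JQ`. [cite: Zharkov2020TropicalWeil, §2 (pp. 2–4)] -/
theorem mulVec_weilJ_mulVec {Q : Matrix (Fin (2 * n)) (Fin (2 * n)) ℝ} (hQJ : Q * weilJ n = weilJ n * Q)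
    (w : Fin (2 * n) → ℝ) : Q *ᵥ (weilJ n *ᵥ w) = weilJ n *ᵥ (Q *ᵥ w) := by
  rw [Matrix.mulVec_mulVec, Matrix.mulVec_mulVec, hQJ]

/-- `Q[Jw] = Q[w]`: `J` is a `Q`-isometry (`QJ = JQ`, `JᵀJ = 1`). [cite: Zharkov2020TropicalWeil, §2 (pp. 2–4)] -/
theorem quadForm_weilJ_mulVec {Q : Matrix (Fin (2 * n)) (Fin (2 * n)) ℝ} (hQJ : Q * weilJ n = weilJ n * Q)
    (w : Fin (2 * n) → ℝ) : (weilJ n *ᵥ w) ⬝ᵥ (Q *ᵥ (weilJ n *ᵥ w)) = w ⬝ᵥ (Q *ᵥ w) := by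
  rw [mulVec_weilJ_mulVec hQJ, weilJ_mulVec_dotProduct_weilJ_mulVec]

/-- `⟨w, Jw⟩_Q = 0` for symmetric `Q` commuting with `J` (`QJ` is antisymmetric). [cite: Zharkov2020TropicalWeil, §2 (pp. 2–4)] -/
theorem dotProduct_mulVec_weilJ_mulVec_self {Q : Matrix (Fin (2 * n)) (Fin (2 * n)) ℝ} (hQ : Qᵀ = Q)
    (hQJ : Q * weilJ n = weilJ n * Q) (w : Fin (2 * n) → ℝ) : w ⬝ᵥ (Q *ᵥ (weilJ n *ᵥ w)) = 0 := by
  have h1 : w ⬝ᵥ (Q *ᵥ (weilJ n *ᵥ w)) = -((weilJ n *ᵥ w) ⬝ᵥ (Q *ᵥ w)) := by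
    rw [mulVec_weilJ_mulVec hQJ, weilJ_mulVec_dotProduct, neg_neg]
  have h2 : (weilJ n *ᵥ w) ⬝ᵥ (Q *ᵥ w) = w ⬝ᵥ (Q *ᵥ (weilJ n *ᵥ w)) := by
    rw [Matrix.dotProduct_mulVec, ← Matrix.mulVec_transpose, hQ, dotProduct_comm]
  linarith

/-- `φ_c` preserves the `Q`-distance to `c`: `Q[φ_c p - c] = Q[p - c]`. So `φ_c` permutes the nearest lattice points of a fixed
point `c`, and every sphere of lattice points about `c`. [folklore] -/
theorem quadForm_rot_sub_center {Q : Matrix (Fin (2 * n)) (Fin (2 * n)) ℝ} (hQJ : Q * weilJ n = weilJ n * Q)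
    (c p : Fin (2 * n) → ℝ) :
    (weilJ n *ᵥ p - (weilJ n *ᵥ c - c) - c) ⬝ᵥ (Q *ᵥ (weilJ n *ᵥ p - (weilJ n *ᵥ c - c) - c)) =
      (p - c) ⬝ᵥ (Q *ᵥ (p - c)) := by
  rw [rot_sub_center, quadForm_weilJ_mulVec hQJ]

/-- **A `φ_c`-orbit is a Q-square centred at `c`.** For `p = c + w`: `φ_c p = c + Jw`, `φ_c² p = c - w`, `φ_c³ p = c - Jw`; the
four sides `(c+Jw)-(c+w)`, `(c-w)-(c+Jw)`, … all have `Q`-length `2·Q[w]` and consecutive sides are `Q`-orthogonal. Stated for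
the first two sides (the others follow by applying `φ_c`). [folklore] -/
theorem rot_orbit_isSquare {Q : Matrix (Fin (2 * n)) (Fin (2 * n)) ℝ} (hQ : Qᵀ = Q) (hQJ : Q * weilJ n = weilJ n * Q)
    (c w : Fin (2 * n) → ℝ) :
    weilJ n *ᵥ (c + w) - (weilJ n *ᵥ c - c) = c + weilJ n *ᵥ w ∧
    (weilJ n *ᵥ w - w) ⬝ᵥ (Q *ᵥ (weilJ n *ᵥ w - w)) = 2 * (w ⬝ᵥ (Q *ᵥ w)) ∧
    (-w - weilJ n *ᵥ w) ⬝ᵥ (Q *ᵥ (-w - weilJ n *ᵥ w)) = 2 * (w ⬝ᵥ (Q *ᵥ w)) ∧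
    (weilJ n *ᵥ w - w) ⬝ᵥ (Q *ᵥ (-w - weilJ n *ᵥ w)) = 0 := by
  have hJJ := quadForm_weilJ_mulVec hQJ w
  have h0 := dotProduct_mulVec_weilJ_mulVec_self hQ hQJ w
  have h0' : (weilJ n *ᵥ w) ⬝ᵥ (Q *ᵥ w) = 0 := by
    rw [Matrix.dotProduct_mulVec, ← Matrix.mulVec_transpose, hQ, dotProduct_comm]; exact h0
  refine ⟨?_, ?_, ?_, ?_⟩
  · rw [Matrix.mulVec_add]; abel
  · simp only [Matrix.mulVec_sub, sub_dotProduct, dotProduct_sub, hJJ, h0, h0']; ring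
  · simp only [Matrix.mulVec_sub, Matrix.mulVec_neg, sub_dotProduct, dotProduct_sub, neg_dotProduct, dotProduct_neg,
      hJJ, h0, h0']; ring
  · simp only [Matrix.mulVec_sub, Matrix.mulVec_neg, sub_dotProduct, dotProduct_sub, dotProduct_neg,
      hJJ, h0, h0']; ring

/-- **Every lattice Q-square is centred at a fixed point of `J`.** For the square `{a, a+e, a+Je, a+e+Je}` with centre
`m = a + (e + Je)/2`: `2m = 2a + e + Je = (J+1)(a - Ja + e)` (because `(J+1)(1-J) = 2`); with `a, e` integral the vector
`a - Ja + e` is integral, so `2m ∈ (J+1)ℤ²ⁿ` and `m` is a fixed point of `J` on `ℝ²ⁿ/ℤ²ⁿ` by `fixed_iff`. [folklore] -/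
theorem two_smul_squareCenter (a e : Fin (2 * n) → ℝ) :
    (2 : ℝ) • a + (e + weilJ n *ᵥ e) =
      weilJ n *ᵥ (a - weilJ n *ᵥ a + e) + (a - weilJ n *ᵥ a + e) := by
  simp only [Matrix.mulVec_add, Matrix.mulVec_sub, weilJ_mulVec_weilJ_mulVec, two_smul]
  abel

/-! ### Free `ℤ/4`: `4 ∣ #s` for every finite `φ_c`-stable set of points avoiding `c` -/

/-- **`4` divides the cardinality of every finite `φ_c`-stable set not containing `c`.** (The orbit `p, φ_c p, φ_c² p, φ_c³ p`
of any `p ∈ s` consists of four distinct points of `s` — none is fixed by `φ_c` or `φ_c²` — and `s` minus the orbit is again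
stable; induct.) Applied to the nearest lattice points of a non-zero fixed point `c` of `J` (stable by `quadForm_rot_sub_center`
and `rot_intCast`), and to the vertex sets, facet sets, … of the dual Voronoi face, it gives: the Delaunay face at `c` has `4k`
vertices, and all face numbers of its star are `≡ 0 (mod 4)`. [folklore] -/
theorem four_dvd_card_of_rot_stable (c : Fin (2 * n) → ℝ) (s : Finset (Fin (2 * n) → ℝ)) (hc : c ∉ s)
    (hs : ∀ p ∈ s, weilJ n *ᵥ p - (weilJ n *ᵥ c - c) ∈ s) : 4 ∣ s.card := by
  set φ : (Fin (2 * n) → ℝ) → (Fin (2 * n) → ℝ) := fun q => weilJ n *ᵥ q - (weilJ n *ᵥ c - c) with hφ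
  have hinj : Function.Injective φ := rot_injective c
  have hφφ : ∀ q, φ (φ q) = (2 : ℝ) • c - q := fun q => rot_rot c q
  -- strong induction on the cardinality
  induction' hN : s.card using Nat.strong_induction_on with N ih generalizing s
  rcases s.eq_empty_or_nonempty with rfl | ⟨p, hp⟩
  · simp only [Finset.card_empty] at hN
    subst hN; exact dvd_zero 4
  · have hpc : p ≠ c := fun h => hc (h ▸ hp)
    have h1 : φ p ∈ s := hs p hp
    have h2 : φ (φ p) ∈ s := hs _ h1
    have h3 : φ (φ (φ p)) ∈ s := hs _ h2
    have hp1c : φ p ≠ c := fun h => hc (h ▸ h1)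
    have hp2c : φ (φ p) ≠ c := fun h => hc (h ▸ h2)
    -- the four points are distinct
    have d01 : p ≠ φ p := fun h => rot_ne_self hpc h.symm
    have d02 : p ≠ φ (φ p) := fun h => rot_rot_ne_self hpc h.symm
    have d12 : φ p ≠ φ (φ p) := fun h => rot_ne_self hp1c h.symm
    have d13 : φ p ≠ φ (φ (φ p)) := fun h => rot_rot_ne_self hp1c h.symm
    have d23 : φ (φ p) ≠ φ (φ (φ p)) := fun h => rot_ne_self hp2c h.symm
    have h4 : φ (φ (φ (φ p))) = p := by rw [hφφ, hφφ]; simp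
    have d03 : p ≠ φ (φ (φ p)) := by
      intro h
      have h' : φ p = p := by
        have h'' := congrArg φ h
        rw [h4] at h''; exact h''
      exact d01 h'.symm
    set O : Finset (Fin (2 * n) → ℝ) := {p, φ p, φ (φ p), φ (φ (φ p))} with hO
    have hOcard : O.card = 4 := by
      rw [hO, Finset.card_insert_of_notMem, Finset.card_insert_of_notMem, Finset.card_insert_of_notMem,
        Finset.card_singleton]
      · simpa using d23
      · simp [d12, d13]
      · simp [d01, d02, d03]
    have hOs : O ⊆ s := by
      intro q hq
      simp only [hO, Finset.mem_insert, Finset.mem_singleton] at hq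
      rcases hq with rfl | rfl | rfl | rfl <;> assumption
    have hOstab : ∀ q ∈ O, φ q ∈ O := by
      intro q hq
      simp only [hO, Finset.mem_insert, Finset.mem_singleton] at hq ⊢
      rcases hq with rfl | rfl | rfl | rfl
      · exact Or.inr (Or.inl rfl)
      · exact Or.inr (Or.inr (Or.inl rfl))
      · exact Or.inr (Or.inr (Or.inr rfl))
      · exact Or.inl h4
    -- the complement is stable
    set s' := s \ O with hs'
    have hc' : c ∉ s' := fun h => hc (Finset.sdiff_subset h)
    have hs'stab : ∀ q ∈ s', φ q ∈ s' := by
      intro q hq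
      rw [hs', Finset.mem_sdiff] at hq ⊢
      refine ⟨hs q hq.1, fun hφq => hq.2 ?_⟩
      -- φ q ∈ O = φ(O) ⟹ q ∈ O
      have : ∃ r ∈ O, φ r = φ q := by
        simp only [hO, Finset.mem_insert, Finset.mem_singleton] at hφq
        rcases hφq with h | h | h | h
        · exact ⟨φ (φ (φ p)), by simp [hO], by rw [h4, h]⟩
        · exact ⟨p, by simp [hO], h.symm⟩
        · exact ⟨φ p, by simp [hO], h.symm⟩
        · exact ⟨φ (φ p), by simp [hO], h.symm⟩
      obtain ⟨r, hr, hrq⟩ := this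
      rwa [← hinj hrq]
    have hcard : s.card = s'.card + 4 := by
      rw [hs', ← hOcard]; exact (Finset.card_sdiff_add_card_eq_card hOs).symm
    have hlt : s'.card < N := by rw [← hN, hcard]; omega
    have ih' := ih s'.card hlt s' hc' hs'stab rfl
    rw [← hN, hcard]
    exact Dvd.dvd.add ih' (dvd_refl 4)

end Summit.HodgeConjecture.HodgeConjecture.Theorems.TropicalWeilVanishing.FixedPoints

end
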